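import Summits.CriticalPhenomena.PercolationContinuityZ3.Theorems.Transplant.SkelFrmBChoiceRootLanding
import HarnessLib

/-!
# N2 (frames-only node `SamePDropOfSkeletonFrm₁`, OPEN), (R) column FIRST axis — **(R-47)(a): THE BRIDGE LANDING ON THE TERMINAL'S SHEAR LINE**
# (`PlanarSkeletonFrm.NegB.KS.Y1s / D0s`; `rows_c₁s_zero`, `exists_landing0s`, the six cross-link rows `hx_rows_0s` at `(X1, Y1s)` under the width floor
# `prB0 + ℓB0 + 5·R′0 + 2 ≤ W`, and **`hx_0s`** = the skeleton's `hx` at the new landing).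
WHY (J25/(R-47), lane INBOX 2026-08-23T12:5xZ, p3-g17): RootLanding's `Y1 = h_L − R′0 + hB0 + ⌊h_L q/n_L⌋` puts `c₁` on the shear line through the bridge's
`core1Lo`, whose row offset from `t`, `(n_L·hB0 − h_L·nB0 + …)/U`, is only bounded by `prB0 + R′0 + 1 ≤ f` rows and enters the root's x-arrival rows
reading (against `c 0`) and the second-axis cross link; `Y1s := ⌈h_L·X1/n_L⌉` puts `c₁* := t + (X1, Y1s)` on the shear line through `t` (`rows = 0`), so the
x-corridor from `c₁*` reads exactly like (C)'s; the price is the cross-link's across budget `W ≥ prB0 + ℓB0 + 5R′0 + 2` (the bridge's core-1 box is now up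
to `prB0 + R′0` rows off the origin), paid by the node coupling `f ≤ 12·sL` ((R-47)(b), stmt's union).  `X1`, `RootRun` unchanged.
builds on p205010 (kernel theorem, internal audit signed; external expert review pending) — nothing in this file uses p205010; nothing here is a
claim about the open node `SamePDropOfSkeletonFrm₁`.
Lane `prim-bschramm`, seat `prim-bschramm-p3` (gen 17; (R) lineage); helper file (`--supports stmt-CriticalPhenomena-4575 --as helper`).
[cite: KozmaNitzan2024, §4 Lemma 11 (p. 22: the cross link), p. 28 ((32) at the root)]
-/

noncomputable section

open scoped Classical

namespace Summit.CriticalPhenomena.PercolationContinuityZ3.Theorems.Transplant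

namespace PlanarSkeletonFrm

namespace NegB

open Literature.Probability.Percolation Literature.Probability.LatticeModels SimpleGraph
open Literature.Barriers.CriticalPhenomena (graphBall)
open SkelConc (Consts)
open Skelφ (rootFrame shearUnit)
open ChainPlanar (BridgePrm BridgeOK)
open Neg

namespace KS

section Landing2

variable (κ : Consts) {V : Type} [DecidableEq V] [Countable V] {G : SimpleGraph V} [G.LocallyFinite] (Φ : PlanarSkeletonFrm G) (t : V) (p : unitInterval)
  (D : Skelφ.StepI.DataNS V) (mk g f qq : ℕ)

/-- **The landing height on the terminal's shear line** `Y1s := ⌈h_L·X1/n_L⌉`. [this work] -/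
def Y1s : ℤ := -((-((hL κ Φ t p D g f) * (X1 κ Φ t p D mk g f qq))) / (nL κ Φ t p D g f : ℤ))

/-- **The landing depth** `D0s := |X1| + |Y1s|`. [this work] -/
def D0s : ℕ := ((X1 κ Φ t p D mk g f qq)).natAbs + ((Y1s κ Φ t p D mk g f qq)).natAbs

/-- **The landing sits on the shear line through `t`**: `0 ≤ n_L·Y1s − h_L·X1 < n_L` and `⌊(n_L·Y1s − h_L·X1)/U⌋ = 0`. [folklore] -/
theorem rows_c₁s_zero (hN : EqNumL κ Φ t p D g f) :
    0 ≤ (nL κ Φ t p D g f : ℤ) * (Y1s κ Φ t p D mk g f qq) - (hL κ Φ t p D g f) * (X1 κ Φ t p D mk g f qq) ∧ (nL κ Φ t p D g f : ℤ) * (Y1s κ Φ t p D mk g f qq) - (hL κ Φ t p D g f) * (X1 κ Φ t p D mk g f qq) < (nL κ Φ t p D g f : ℤ) ∧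
      ((nL κ Φ t p D g f : ℤ) * (Y1s κ Φ t p D mk g f qq) - (hL κ Φ t p D g f) * (X1 κ Φ t p D mk g f qq)) / (shearUnit (nL κ Φ t p D g f) (hL κ Φ t p D g f) : ℤ) = 0 := by
  have hn1 : (1 : ℤ) ≤ (nL κ Φ t p D g f : ℤ) := by exact_mod_cast (one_le_of_eqNumL κ Φ t p D g f hN).1
  have hn0 : (0 : ℤ) < (nL κ Φ t p D g f : ℤ) := by linarith
  have hY : (Y1s κ Φ t p D mk g f qq) = -((-((hL κ Φ t p D g f) * (X1 κ Φ t p D mk g f qq))) / (nL κ Φ t p D g f : ℤ)) := rfl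
  have h1 := Int.ediv_mul_le (-((hL κ Φ t p D g f) * (X1 κ Φ t p D mk g f qq))) (ne_of_gt hn0)
  have h2 := Int.lt_ediv_add_one_mul_self (-((hL κ Φ t p D g f) * (X1 κ Φ t p D mk g f qq))) hn0
  have hlo : 0 ≤ (nL κ Φ t p D g f : ℤ) * (Y1s κ Φ t p D mk g f qq) - (hL κ Φ t p D g f) * (X1 κ Φ t p D mk g f qq) := by rw [hY]; nlinarith
  have hhi : (nL κ Φ t p D g f : ℤ) * (Y1s κ Φ t p D mk g f qq) - (hL κ Φ t p D g f) * (X1 κ Φ t p D mk g f qq) < (nL κ Φ t p D g f : ℤ) := by rw [hY]; nlinarith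
  refine ⟨hlo, hhi, ?_⟩
  have hU : (nL κ Φ t p D g f : ℤ) ≤ (shearUnit (nL κ Φ t p D g f) (hL κ Φ t p D g f) : ℤ) := by
    unfold Skelφ.shearUnit; push_cast
    have := abs_nonneg (hL κ Φ t p D g f)
    have : (((hL κ Φ t p D g f)).natAbs : ℤ) = |(hL κ Φ t p D g f)| := Int.natCast_natAbs _
    linarith
  exact Int.ediv_eq_zero_of_lt hlo (lt_of_lt_of_le hhi hU)

/-- **THE LANDING VERTEX EXISTS** (any planar map with unit steps): `c₁* ∈ B_G(t, D0s)` with `ψ c₁* − ψ t = (X1, Y1s)`. [folklore] -/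
theorem exists_landing0s {ψ : V → Site 2} (hstep : Skelφ.Steps G ψ) :
    ∃ c₁, c₁ ∈ graphBall G t (D0s κ Φ t p D mk g f qq) ∧ ψ c₁ 0 - ψ t 0 = (X1 κ Φ t p D mk g f qq) ∧ ψ c₁ 1 - ψ t 1 = (Y1s κ Φ t p D mk g f qq) := by
  obtain ⟨c₁, hc, hy⟩ := Skelφ.exists_mem_graphBall_φ_eq hstep t (ψ t + Skelφ.pt (X1 κ Φ t p D mk g f qq) (Y1s κ Φ t p D mk g f qq))
  have e0 : (ψ t + Skelφ.pt (X1 κ Φ t p D mk g f qq) (Y1s κ Φ t p D mk g f qq)) 0 - ψ t 0 = (X1 κ Φ t p D mk g f qq) := by simp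
  have e1 : (ψ t + Skelφ.pt (X1 κ Φ t p D mk g f qq) (Y1s κ Φ t p D mk g f qq)) 1 - ψ t 1 = (Y1s κ Φ t p D mk g f qq) := by simp
  rw [e0, e1] at hc
  refine ⟨c₁, hc, ?_, ?_⟩
  · have := congrFun hy 0; simp only [Pi.add_apply, Skelφ.pt_zero] at this; linarith
  · have := congrFun hy 1; simp only [Pi.add_apply, Skelφ.pt_one] at this; linarith

/-- **THE SIX ROWS OF THE CROSS LINK AT THE NEW LANDING** `(X1, Y1s)`: along exact as before (`R′0 ≤ q`); across, the bridge's core-1 box sits within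
`(prB0 + R′0 + 1)·U + n_L(ℓ_L + 2R′0 + ℓB0) + 2|h_L|R′0` of the origin's shear line (`|hB0|, nB0 ≤ prB0`, `n_L·h_L = h_L·n_L`), absorbed by
`(P + W)·U ≥ n_Lℓ_L + 1 + W·U` once `prB0 + ℓB0 + 5R′0 + 2 ≤ W`. [cite: KozmaNitzan2024, §4 Lemma 11 (p. 22)] -/
theorem hx_rows_0s {W : ℕ} (hN : EqNumL κ Φ t p D g f) (hW : ((prB0 κ Φ t p D mk) : ℤ) + (ℓB0 κ Φ t p D mk) + 5 * (KS0.R'0 κ Φ t p D mk : ℤ) + 2 ≤ W) (hRq : KS0.R'0 κ Φ t p D mk ≤ qq) :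
    (X1 κ Φ t p D mk g f qq) - qq ≤ (B0 κ Φ t p D mk g f).core1Lo 0 ∧ (B0 κ Φ t p D mk g f).core1Hi 0 ≤ (X1 κ Φ t p D mk g f qq) + qq ∧
    -((((nL κ Φ t p D g f) * (ℓL κ Φ t p D g f) / shearUnit (nL κ Φ t p D g f) (hL κ Φ t p D g f) + 1 + W : ℕ) : ℤ) * (shearUnit (nL κ Φ t p D g f) (hL κ Φ t p D g f) : ℤ)) ≤ (nL κ Φ t p D g f : ℤ) * ((B0 κ Φ t p D mk g f).core1Lo 1 - (Y1s κ Φ t p D mk g f qq)) - (hL κ Φ t p D g f) * ((B0 κ Φ t p D mk g f).core1Lo 0 - (X1 κ Φ t p D mk g f qq)) ∧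
    -((((nL κ Φ t p D g f) * (ℓL κ Φ t p D g f) / shearUnit (nL κ Φ t p D g f) (hL κ Φ t p D g f) + 1 + W : ℕ) : ℤ) * (shearUnit (nL κ Φ t p D g f) (hL κ Φ t p D g f) : ℤ)) ≤ (nL κ Φ t p D g f : ℤ) * ((B0 κ Φ t p D mk g f).core1Lo 1 - (Y1s κ Φ t p D mk g f qq)) - (hL κ Φ t p D g f) * ((B0 κ Φ t p D mk g f).core1Hi 0 - (X1 κ Φ t p D mk g f qq)) ∧
    (nL κ Φ t p D g f : ℤ) * ((B0 κ Φ t p D mk g f).core1Hi 1 - (Y1s κ Φ t p D mk g f qq)) - (hL κ Φ t p D g f) * ((B0 κ Φ t p D mk g f).core1Lo 0 - (X1 κ Φ t p D mk g f qq)) ≤ (((nL κ Φ t p D g f) * (ℓL κ Φ t p D g f) / shearUnit (nL κ Φ t p D g f) (hL κ Φ t p D g f) + 1 + W : ℕ) : ℤ) * (shearUnit (nL κ Φ t p D g f) (hL κ Φ t p D g f) : ℤ) ∧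
    (nL κ Φ t p D g f : ℤ) * ((B0 κ Φ t p D mk g f).core1Hi 1 - (Y1s κ Φ t p D mk g f qq)) - (hL κ Φ t p D g f) * ((B0 κ Φ t p D mk g f).core1Hi 0 - (X1 κ Φ t p D mk g f qq)) ≤ (((nL κ Φ t p D g f) * (ℓL κ Φ t p D g f) / shearUnit (nL κ Φ t p D g f) (hL κ Φ t p D g f) + 1 + W : ℕ) : ℤ) * (shearUnit (nL κ Φ t p D g f) (hL κ Φ t p D g f) : ℤ) := by
  have hn := (one_le_of_eqNumL κ Φ t p D g f hN).1
  obtain ⟨c0, c1, c2, c3⟩ := B0_core1 κ Φ t p D mk g f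
  obtain ⟨hr0, hrn, -⟩ := rows_c₁s_zero κ Φ t p D mk g f qq hN
  have hn0 : (0 : ℤ) < (nL κ Φ t p D g f : ℤ) := by exact_mod_cast hn
  have hR0 : (0 : ℤ) ≤ (KS0.R'0 κ Φ t p D mk : ℤ) := by positivity
  have hRq' : (((KS0.R'0 κ Φ t p D mk) : ℕ) : ℤ) ≤ (qq : ℤ) := by exact_mod_cast hRq
  have hW0 : (0 : ℤ) ≤ (W : ℤ) := by positivity
  have hℓ0 : (0 : ℤ) ≤ ((ℓL κ Φ t p D g f) : ℤ) := by positivity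
  have hℓB0 : (0 : ℤ) ≤ ((ℓB0 κ Φ t p D mk) : ℤ) := by positivity
  -- |hB0| ≤ prB0, nB0 ≤ prB0
  have hpr := le_prB0 κ Φ t p D mk
  have hnB : (((nB0 κ Φ t p D mk) : ℕ) : ℤ) ≤ (prB0 κ Φ t p D mk) := by exact_mod_cast hpr.1
  have hhB : |(hB0 κ Φ t p D mk)| ≤ ((prB0 κ Φ t p D mk) : ℤ) := by
    have h2 : ((3 * (ℓB0 κ Φ t p D mk) + ((hB0 κ Φ t p D mk)).natAbs : ℕ) : ℤ) ≤ (prB0 κ Φ t p D mk) := by exact_mod_cast hpr.2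
    push_cast [Int.natCast_natAbs] at h2; linarith
  obtain ⟨hhB1, hhB2⟩ := abs_le.1 hhB
  have hnB0 : (0 : ℤ) ≤ (((nB0 κ Φ t p D mk) : ℕ) : ℤ) := by positivity
  -- the shear unit and the budget
  have hU : (shearUnit (nL κ Φ t p D g f) (hL κ Φ t p D g f) : ℤ) = (nL κ Φ t p D g f : ℤ) + |(hL κ Φ t p D g f)| := by
    unfold Skelφ.shearUnit; push_cast [Int.natCast_natAbs]; rfl
  have hB := budget_mul_shearUnit_ge (nL κ Φ t p D g f) (ℓL κ Φ t p D g f) W (hL κ Φ t p D g f) hn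
  rw [hU] at hB ⊢
  have habs : (0 : ℤ) ≤ |(hL κ Φ t p D g f)| := abs_nonneg _
  obtain ⟨hh1, hh2⟩ := abs_le.1 (le_refl |(hL κ Φ t p D g f)|)
  -- products against |h_L| and n_L
  have p1 : |(hL κ Φ t p D g f) * (((nB0 κ Φ t p D mk) : ℕ) : ℤ)| ≤ |(hL κ Φ t p D g f)| * (prB0 κ Φ t p D mk) := by rw [abs_mul, abs_of_nonneg hnB0]; exact mul_le_mul_of_nonneg_left hnB habs
  obtain ⟨p1a, p1b⟩ := abs_le.1 p1
  have p2 : |(hL κ Φ t p D g f) * (KS0.R'0 κ Φ t p D mk : ℤ)| = |(hL κ Φ t p D g f)| * (KS0.R'0 κ Φ t p D mk : ℤ) := by rw [abs_mul, abs_of_nonneg hR0]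
  obtain ⟨p2a, p2b⟩ := abs_le.1 (le_of_eq p2)
  have p3 : |(nL κ Φ t p D g f : ℤ) * (hB0 κ Φ t p D mk)| ≤ (nL κ Φ t p D g f : ℤ) * (prB0 κ Φ t p D mk) := by rw [abs_mul, abs_of_nonneg hn0.le]; exact mul_le_mul_of_nonneg_left hhB hn0.le
  obtain ⟨p3a, p3b⟩ := abs_le.1 p3
  have hWU : (((prB0 κ Φ t p D mk) : ℤ) + (ℓB0 κ Φ t p D mk) + 5 * (KS0.R'0 κ Φ t p D mk : ℤ) + 2) * ((nL κ Φ t p D g f : ℤ) + |(hL κ Φ t p D g f)|) ≤ (W : ℤ) * ((nL κ Φ t p D g f : ℤ) + |(hL κ Φ t p D g f)|) :=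
    mul_le_mul_of_nonneg_right hW (by positivity)
  have e1 : (W : ℤ) * (nL κ Φ t p D g f : ℤ) + (W : ℤ) * |(hL κ Φ t p D g f)| = (W : ℤ) * ((nL κ Φ t p D g f : ℤ) + |(hL κ Φ t p D g f)|) := by ring
  have hpr0 : (0 : ℤ) ≤ ((prB0 κ Φ t p D mk) : ℤ) := by positivity
  have q1 : (0 : ℤ) ≤ (nL κ Φ t p D g f : ℤ) * ((ℓB0 κ Φ t p D mk) : ℤ) := by positivity
  have q2 : (0 : ℤ) ≤ (nL κ Φ t p D g f : ℤ) * (KS0.R'0 κ Φ t p D mk : ℤ) := by positivity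
  have q3 : (0 : ℤ) ≤ |(hL κ Φ t p D g f)| * (KS0.R'0 κ Φ t p D mk : ℤ) := by positivity
  have q4 : (0 : ℤ) ≤ |(hL κ Φ t p D g f)| * ((prB0 κ Φ t p D mk) : ℤ) := by positivity
  have q5 : (0 : ℤ) ≤ (nL κ Φ t p D g f : ℤ) * ((prB0 κ Φ t p D mk) : ℤ) := by positivity
  have q6 : (0 : ℤ) ≤ |(hL κ Φ t p D g f)| * ((ℓB0 κ Φ t p D mk) : ℤ) := by positivity
  have q7 : (0 : ℤ) ≤ (nL κ Φ t p D g f : ℤ) * ((ℓL κ Φ t p D g f) : ℤ) := by positivity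
  -- the sheared coordinate of the origin: n·Y1s = h·X1 + r with r ∈ [0, n)
  rw [c0, c1, c2, c3]
  refine ⟨?_, ?_, ?_, ?_, ?_, ?_⟩
  · rw [X1_eq]; linarith
  · rw [X1_eq]; linarith
  · linarith
  · linarith
  · linarith
  · linarith

/-- **`hx` FOR THE ROOT LEG AT THE NEW LANDING**: at `c₁*` over `(X1, Y1s)`, every root-frame point of the bridge's core-`1` box lies in core `0` of the
corridor `kgCorrSched …` read through `runX ψ c₁* n_L h_L 1`, for every row set `HK` at `R′ := R'0` with `prB0 + ℓB0 + 5R′0 + 2 ≤ W`, `R'0 ≤ q`.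
[cite: KozmaNitzan2024, §4 Lemma 11 (p. 22)] -/
theorem hx_0s {ρ W : ℕ} (hN : EqNumL κ Φ t p D g f)
    (HK : Skelφ.KGRows (nL κ Φ t p D g f) (ℓL κ Φ t p D g f) (hL κ Φ t p D g f) (vL κ Φ t p D g f) (KS0.R'0 κ Φ t p D mk) ρ qq W) (N : ℕ)
    (hW : ((prB0 κ Φ t p D mk) : ℤ) + (ℓB0 κ Φ t p D mk) + 5 * (KS0.R'0 κ Φ t p D mk : ℤ) + 2 ≤ W) (hRq : KS0.R'0 κ Φ t p D mk ≤ qq)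
    {ψ : V → Site 2} {c₁ : V} (hX : ψ c₁ 0 - ψ t 0 = (X1 κ Φ t p D mk g f qq)) (hY : ψ c₁ 1 - ψ t 1 = (Y1s κ Φ t p D mk g f qq))
    {w : V} (hw : rootFrame ψ t 1 w ∈ Finset.Icc (B0 κ Φ t p D mk g f).core1Lo (B0 κ Φ t p D mk g f).core1Hi) :
    Skelφ.runX ψ c₁ (nL κ Φ t p D g f) (hL κ Φ t p D g f) 1 w ∈ (Skelφ.kgCorrSched (HK.kgVals_ok₁ N) (HK.kgVals_ok₂ N) (HK.kgVals_split N)).core 0 := by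
  obtain ⟨hx0, hx1, hs₁, hs₂, hs₃, hs₄⟩ := hx_rows_0s κ Φ t p D mk g f qq hN hW hRq
  exact Skelφ.runX_mem_kgCorrSched_core_zero_of_rootFrame (HK.kgVals_ok₁ N) (HK.kgVals_ok₂ N) (HK.kgVals_split N) HK.hn t c₁ hX hY hx0 hx1 hs₁ hs₂ hs₃ hs₄ hw

end Landing2

end KS

end NegB

end PlanarSkeletonFrm

end Summit.CriticalPhenomena.PercolationContinuityZ3.Theorems.Transplant

end
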